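import Mathlib
import HarnessLib
import Summits.MatrixMultiplication.MatrixMultiplication.Theorems.OutsiderSandwichToricCeilingPowSubTwoGlue

/-!
# OutsiderSandwich — tight-frame toric ceiling `⟨3^N - 2⟩`, part 2/5: translation and star
matchings, the letter law `twice`, and the CROSSED local rule
(decomp-mm lens 4, gen 45, kernel K45; THESES-FREE, `ω`-free; helper toward `LaserTangency`,
stmt-32268 — the extremal subrank/packing cells of the literal host `kroneckerPow (cwTensor ℂ 2) N`)

LABEL.  TORIC · uniform in `N` · NEC-side instrument; infrastructure (part 5 carries the theorem).

WHAT.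
* `isPM_tr`, `isPM_par`, `par_one_ne_two`: translation matchings `u ↦ (u, u+δ, u+2δ)` of the tight
  frame (the parallel classes; two of them differ for `m ≥ 1`); `isPM_star`: the complement of a
  tight triple `(x, y, z)` ("star", one missing word per leg) is matched by the parallel class of
  direction `y - x`.
* `twice a b c d e f` (Boolean): each letter of `Fin 3` occurs exactly twice among six letters —
  the law of the six missing words of a `⟨3^N - 2⟩` at a permutation coordinate
  (`…ToricComplement.tightFrame_two_missing_law`); its symmetries, and the three pivot types
  `pure_letters`, `crossed_letters`, `spread_letters` (finite checks over `Fin 3`).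
* The CROSSED LOCAL RULE `crAux` / `crA₁ … crC₂` (tail letters of the two auxiliary triples from the
  letters of `y_b, y_c, z_b, z_c` at a tail coordinate — the "flip rule") and its specification
  `cr_spec`, `decide`d over `Fin 3`: the auxiliary rows are tight, the two star slots are tight, the
  co-size-2 slot is admissible (`twice`) and the flags `B₁ ≠ y_b`, `C₂ ≠ z_c` hold at every
  coordinate.
All definitions are plain data (`Bool` / letter-valued).
-/

set_option linter.dupNamespace false

namespace Summit.MatrixMultiplication.MatrixMultiplication.Theorems.OutsiderSandwichToricCeilingPowSubTwoRules

open Finset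
open Summit.MatrixMultiplication.MatrixMultiplication.Theorems.OutsiderSandwichToricCeiling (dSlot)
open Summit.MatrixMultiplication.MatrixMultiplication.Theorems.OutsiderSandwichToricCeilingPowFibres
  (Word Tr3 slotB frame)
open Summit.MatrixMultiplication.MatrixMultiplication.Theorems.OutsiderSandwichToricCeilingPowSubTwoGlue

variable {m : ℕ}

/-! ## §3 Translation matchings: full frames and star complements -/

/-- The translation triple `(u, u + δ, u + 2δ)`. [new] -/
def tr (δ u : Word m) : Tr3 m := (u, u + δ, u + (δ + δ))

/-- TRANSLATION MATCHING: for `δ ≠ 0`, `u ↦ (u, u + δ, u + 2δ)` restricted to a word set `S`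
is a diagonal-free perfect matching of `S × (S + δ) × (S + 2δ)` inside the tight frame. -/
theorem isPM_tr (S : Finset (Word m)) (δ : Word m) (hδ : ∀ i, δ i ≠ 0) {X Y Z : Finset (Word m)}
    (hX : univ \ X = S) (hY : univ \ Y = S.image (· + δ)) (hZ : univ \ Z = S.image (· + (δ + δ))) :
    isPM (S.image (tr δ)) X Y Z = true := by
  rw [isPM_iff]
  refine ⟨?_, ?_, ?_, ?_, ?_, ?_, ?_⟩
  · intro t ht
    rw [mem_image] at ht
    obtain ⟨u, -, rfl⟩ := ht
    rw [mem_tfr]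
    intro i
    simpa [tr] using F3.tr_ne (u i) (δ i) (hδ i)
  · intro s hs s' hs' e
    simp only [coe_image, Set.mem_image, mem_coe] at hs hs'
    obtain ⟨u, -, rfl⟩ := hs
    obtain ⟨u', -, rfl⟩ := hs'
    simp only [tr] at e
    rw [e]
  · intro s hs s' hs' e
    simp only [coe_image, Set.mem_image, mem_coe] at hs hs'
    obtain ⟨u, -, rfl⟩ := hs
    obtain ⟨u', -, rfl⟩ := hs'
    simp only [tr] at e
    rw [add_right_cancel e]
  · intro s hs s' hs' e
    simp only [coe_image, Set.mem_image, mem_coe] at hs hs'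
    obtain ⟨u, -, rfl⟩ := hs
    obtain ⟨u', -, rfl⟩ := hs'
    simp only [tr] at e
    rw [add_right_cancel e]
  · rw [image_image, ← hX]
    exact image_id'
  · rw [image_image, hY]; rfl
  · rw [image_image, hZ]; rfl

/-- The PARALLEL CLASS of direction `δ ≠ 0`: a perfect matching of the full tight frame. -/
theorem isPM_par (δ : Fin 3) (hδ : δ ≠ 0) :
    isPM ((univ : Finset (Word m)).image (tr fun _ => δ)) ∅ ∅ ∅ = true := by
  refine isPM_tr univ (fun _ => δ) (fun _ => hδ) (by simp) ?_ ?_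
  · rw [sdiff_empty, image_univ_of_surjective]
    exact fun v => ⟨v - fun _ => δ, sub_add_cancel v _⟩
  · rw [sdiff_empty, image_univ_of_surjective]
    exact fun v => ⟨v - ((fun _ => δ) + fun _ => δ), sub_add_cancel v _⟩

/-- The two parallel classes differ (`m ≥ 1`). -/
theorem par_one_ne_two (hm : 1 ≤ m) :
    (univ : Finset (Word m)).image (tr fun _ => 1) ≠ univ.image (tr fun _ => 2) := by
  intro h
  have hmem : tr (fun _ => (1 : Fin 3)) (0 : Word m) ∈ univ.image (tr fun _ => 2) :=
    h ▸ mem_image_of_mem _ (mem_univ _)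
  rw [mem_image] at hmem
  obtain ⟨u, -, hu⟩ := hmem
  simp only [tr, Prod.mk.injEq] at hu
  obtain ⟨rfl, h2, -⟩ := hu
  have h0 := congrFun h2 ⟨0, hm⟩
  simp only [Pi.add_apply, Pi.zero_apply, zero_add] at h0
  exact absurd h0 (by decide)

/-- The STAR COMPLEMENT `({x}, {y}, {z})` with distinct letters at every coordinate has a perfect
matching: the parallel class of direction `y - x` with the line through `x` removed. -/
theorem isPM_star (x y z : Word m) (h : ∀ i, x i ≠ y i ∧ y i ≠ z i ∧ x i ≠ z i) :
    isPM ((univ.erase x).image (tr (y - x))) {x} {y} {z} = true := by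
  have hδ : ∀ i, (y - x) i ≠ 0 := fun i => by
    rw [Pi.sub_apply]; exact (F3.third (x i) (y i) (z i) (h i).1 (h i).2.1 (h i).2.2).1
  have hy : x + (y - x) = y := add_sub_cancel x y
  have hz : x + ((y - x) + (y - x)) = z := by
    funext i
    simp only [Pi.add_apply, Pi.sub_apply]
    exact (F3.third (x i) (y i) (z i) (h i).1 (h i).2.1 (h i).2.2).2.2.2.2
  refine isPM_tr (univ.erase x) (y - x) hδ (sdiff_singleton_eq_erase x univ) ?_ ?_
  · rw [image_erase (add_left_injective _), image_univ_of_surjective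
      (fun v => ⟨v - (y - x), sub_add_cancel v _⟩), hy, sdiff_singleton_eq_erase]
  · rw [image_erase (add_left_injective _), image_univ_of_surjective
      (fun v => ⟨v - ((y - x) + (y - x)), sub_add_cancel v _⟩), hz, sdiff_singleton_eq_erase]

/-- Two distinct elements of a pair. -/
theorem injOn_pair {α β : Type*} [DecidableEq α] {f : α → β} {s t : α} (h : f s = f t → s = t) :
    Set.InjOn f ({s, t} : Finset α) := by
  intro x hx y hy e
  simp only [coe_insert, coe_singleton, Set.mem_insert_iff, Set.mem_singleton_iff] at hx hy
  rcases hx with rfl | rfl <;> rcases hy with rfl | rfl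
  · rfl
  · exact h e
  · exact (h e.symm).symm
  · rfl

/-- Three elements with pairwise distinct values. -/
theorem injOn_triple {α β : Type*} [DecidableEq α] {f : α → β} {r s t : α} (h₁ : f r ≠ f s)
    (h₂ : f s ≠ f t) (h₃ : f r ≠ f t) : Set.InjOn f ({r, s, t} : Finset α) := by
  intro x hx y hy e
  simp only [coe_insert, coe_singleton, Set.mem_insert_iff, Set.mem_singleton_iff] at hx hy
  rcases hx with rfl | rfl | rfl <;> rcases hy with rfl | rfl | rfl <;>
    first | rfl | exact absurd e h₁ | exact absurd e.symm h₁ | exact absurd e h₂ |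
      exact absurd e.symm h₂ | exact absurd e h₃ | exact absurd e.symm h₃

/-- Tails of distinct words with the same pivot letter are distinct. -/
theorem tl_ne {p : Fin (m + 1)} {w₁ w₂ : Word (m + 1)} (hne : w₁ ≠ w₂) (he : w₁ p = w₂ p) :
    tl p w₁ ≠ tl p w₂ := fun htl => hne (by rw [← ins_tl p w₁, ← ins_tl p w₂, he, htl])

/-- A word of length `m ≥ 1` outside a given pair. -/
theorem exists_not_pair (hm : 1 ≤ m) (u₁ u₂ : Word m) : ∃ u : Word m, u ≠ u₁ ∧ u ≠ u₂ := by
  have hlt : #({u₁, u₂} : Finset (Word m)) < #(univ : Finset (Word m)) := by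
    calc #({u₁, u₂} : Finset (Word m)) ≤ 2 := card_le_two
      _ < 3 ^ 1 := by norm_num
      _ ≤ 3 ^ m := Nat.pow_le_pow_right (by norm_num) hm
      _ = #(univ : Finset (Word m)) := by simp
  obtain ⟨u, -, hu⟩ := exists_mem_notMem_of_card_lt_card hlt
  simp only [mem_insert, mem_singleton, not_or] at hu
  exact ⟨u, hu.1, hu.2⟩

/-! ## §5 Letter-count admissibility and the local rules (finite checks over `Fin 3`) -/

set_option synthInstance.maxHeartbeats 400000
set_option synthInstance.maxSize 4096

/-- EACH LETTER EXACTLY TWICE among six letters — the admissibility law of the six missing words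
of a toric `⟨3^N - 2⟩` at a permutation coordinate (`…ToricComplement.tightFrame_two_missing_law`),
as a Boolean. [new] -/
def twice (a b c d e f : Fin 3) : Bool :=
  decide (∀ α : Fin 3, (if a = α then 1 else 0) + (if b = α then 1 else 0) +
    ((if c = α then 1 else 0) + (if d = α then 1 else 0)) +
    ((if e = α then 1 else 0) + (if f = α then 1 else 0)) = (2 : ℕ))

/-- `twice` unfolded: every letter occurs exactly twice among the six. -/
theorem twice_iff {a b c d e f : Fin 3} : twice a b c d e f = true ↔
    ∀ α : Fin 3, (if a = α then 1 else 0) + (if b = α then 1 else 0) +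
      ((if c = α then 1 else 0) + (if d = α then 1 else 0)) +
      ((if e = α then 1 else 0) + (if f = α then 1 else 0)) = (2 : ℕ) := by
  rw [twice, decide_eq_true_iff]

/-- `twice` is invariant under swapping the two `y`-letters. -/
theorem twice_swap_y : ∀ a b c d e f : Fin 3, twice a b c d e f = true → twice a b d c e f = true := by
  decide

/-- `twice` is invariant under swapping the two `z`-letters. -/
theorem twice_swap_z : ∀ a b c d e f : Fin 3, twice a b c d e f = true → twice a b c d f e = true := by
  decide

/-- `twice` is invariant under rotating the three pairs. -/
theorem twice_rot : ∀ a b c d e f : Fin 3, twice a b c d e f = true → twice c d e f a b = true := by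
  decide

/-- `twice` is invariant under swapping the two `x`-letters. -/
theorem twice_swap_x : ∀ a b c d e f : Fin 3, twice a b c d e f = true → twice b a c d e f = true := by
  decide

/-- Two distinct letters and a third distinct from both cover `Fin 3`. -/
theorem F3.cover : ∀ ξ η ζ u : Fin 3, ξ ≠ η → η ≠ ζ → ξ ≠ ζ → u = ξ ∨ u = η ∨ u = ζ := by decide

/-- PURE pivot (both `x`'s and both `y`'s doubled): the letters. -/
theorem pure_letters : ∀ x₁ x₂ y₁ y₂ z₁ z₂ : Fin 3, twice x₁ x₂ y₁ y₂ z₁ z₂ = true → x₁ = x₂ →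
    y₁ = y₂ → y₁ - x₁ ≠ 0 ∧ y₁ = x₁ + (y₁ - x₁) ∧ z₁ = x₁ + (y₁ - x₁) + (y₁ - x₁) ∧
      z₂ = x₁ + (y₁ - x₁) + (y₁ - x₁) := by
  decide

/-- CROSSED pivot (the `x`'s doubled, the `y`'s not): the letters. -/
theorem crossed_letters : ∀ x₁ x₂ y₁ y₂ z₁ z₂ : Fin 3, twice x₁ x₂ y₁ y₂ z₁ z₂ = true →
    x₁ = x₂ → y₁ ≠ y₂ → (x₁ ≠ y₁ ∧ x₁ ≠ y₂) ∧ ((z₁ = y₁ ∧ z₂ = y₂) ∨ (z₁ = y₂ ∧ z₂ = y₁)) := by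
  decide

/-- SPREAD pivot (no pair doubled): the omitted letters `ξ = -(x₁+x₂)`, `η = -(y₁+y₂)`,
`ζ = -(z₁+z₂)` are distinct and the words carry the letters `x ↦ {η, ζ}`, `y ↦ {ξ, ζ}`,
`z ↦ {ξ, η}`. -/
theorem spread_letters : ∀ x₁ x₂ y₁ y₂ z₁ z₂ : Fin 3, twice x₁ x₂ y₁ y₂ z₁ z₂ = true → x₁ ≠ x₂ →
    y₁ ≠ y₂ → z₁ ≠ z₂ →
    (-(x₁ + x₂) ≠ -(y₁ + y₂) ∧ -(y₁ + y₂) ≠ -(z₁ + z₂) ∧ -(x₁ + x₂) ≠ -(z₁ + z₂)) ∧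
    ((x₁ = -(y₁ + y₂) ∧ x₂ = -(z₁ + z₂)) ∨ (x₂ = -(y₁ + y₂) ∧ x₁ = -(z₁ + z₂))) ∧
    ((y₁ = -(x₁ + x₂) ∧ y₂ = -(z₁ + z₂)) ∨ (y₂ = -(x₁ + x₂) ∧ y₁ = -(z₁ + z₂))) ∧
    ((z₁ = -(x₁ + x₂) ∧ z₂ = -(y₁ + y₂)) ∨ (z₂ = -(x₁ + x₂) ∧ z₁ = -(y₁ + y₂))) := by
  decide

/-- SPREAD letters: with `η = ξ + e`, `ζ = ξ + 2e`, `e ≠ 0`, the rows `(ξ, ζ, η)`, `(η, ξ, ζ)`,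
`(ζ, η, ξ)` have direction `e + e` and `(ξ, η, ζ)` has direction `e`. -/
theorem F3.spread_dirs : ∀ ξ η ζ : Fin 3, ξ ≠ η → η ≠ ζ → ξ ≠ ζ →
    η - ξ ≠ 0 ∧ ξ + (η - ξ) = η ∧ ξ + (η - ξ) + (η - ξ) = ζ ∧ ξ + (η - ξ) + (η - ξ) + (η - ξ) = ξ ∧
    ζ = ξ + ((η - ξ) + (η - ξ)) ∧ ξ = η + ((η - ξ) + (η - ξ)) ∧ η = ζ + ((η - ξ) + (η - ξ)) := by
  decide

/-- CROSSED LOCAL RULE (per tail coordinate): the letters of the two auxiliary triples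
`T° = (A₁, B₁, C₁)` in the slot `(c, b, a)` and `T°° = (A₂, B₂, C₂)` in the slot `(b, a, c)`, from
the letters of `y_b, y_c, z_b, z_c` (flip rule). [new] -/
def crAux (yb yc zb zc : Fin 3) : (Fin 3 × Fin 3 × Fin 3) × (Fin 3 × Fin 3 × Fin 3) :=
  if yc = yb ∨ zb = zc then ((yc, zb, -(yc + zb)), (zb, -(yc + zb), yc))
  else if yc ≠ zb then ((-(yc + zb), yc, zb), (-(yc + zb), yc, zb))
  else ((yc + 1, yc, yc + 2), (yc + 1, yc + 2, yc))

/-- [new] -/ def crA₁ (yb yc zb zc : Fin 3) : Fin 3 := (crAux yb yc zb zc).1.1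
/-- [new] -/ def crB₁ (yb yc zb zc : Fin 3) : Fin 3 := (crAux yb yc zb zc).1.2.1
/-- [new] -/ def crC₁ (yb yc zb zc : Fin 3) : Fin 3 := (crAux yb yc zb zc).1.2.2
/-- [new] -/ def crA₂ (yb yc zb zc : Fin 3) : Fin 3 := (crAux yb yc zb zc).2.1
/-- [new] -/ def crB₂ (yb yc zb zc : Fin 3) : Fin 3 := (crAux yb yc zb zc).2.2.1
/-- [new] -/ def crC₂ (yb yc zb zc : Fin 3) : Fin 3 := (crAux yb yc zb zc).2.2.2

/-- The CROSSED local constraints, as a Boolean. [new] -/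
def crGood (x₁ x₂ yb yc zb zc : Fin 3) : Bool :=
  decide ((crA₁ yb yc zb zc ≠ crB₁ yb yc zb zc ∧ crB₁ yb yc zb zc ≠ crC₁ yb yc zb zc ∧
      crA₁ yb yc zb zc ≠ crC₁ yb yc zb zc) ∧
    (crA₂ yb yc zb zc ≠ crB₂ yb yc zb zc ∧ crB₂ yb yc zb zc ≠ crC₂ yb yc zb zc ∧
      crA₂ yb yc zb zc ≠ crC₂ yb yc zb zc) ∧
    (crA₂ yb yc zb zc ≠ yc ∧ yc ≠ crC₁ yb yc zb zc ∧ crA₂ yb yc zb zc ≠ crC₁ yb yc zb zc) ∧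
    (crA₁ yb yc zb zc ≠ crB₂ yb yc zb zc ∧ crB₂ yb yc zb zc ≠ zb ∧ crA₁ yb yc zb zc ≠ zb) ∧
    twice x₁ x₂ yb (crB₁ yb yc zb zc) zc (crC₂ yb yc zb zc) = true ∧
    (crB₁ yb yc zb zc ≠ yb ∧ crC₂ yb yc zb zc ≠ zc))

/-- The CROSSED rule meets its specification (`crGood`) at every admissible letter configuration
(finite check over `Fin 3`). -/
theorem cr_spec_bool : ∀ x₁ x₂ yb yc zb zc : Fin 3, twice x₁ x₂ yb yc zb zc = true →
    crGood x₁ x₂ yb yc zb zc = true := by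
  decide

/-- THE CROSSED LOCAL LEMMA: both auxiliary rows are tight-frame letters, the two star slots and
the co-size-2 slot are admissible one level down, and the flags `B₁ ≠ y_b`, `C₂ ≠ z_c` hold at EVERY
coordinate (a coincidence would put a letter thrice). -/
theorem cr_spec (x₁ x₂ yb yc zb zc : Fin 3) (h : twice x₁ x₂ yb yc zb zc = true) :
    (crA₁ yb yc zb zc ≠ crB₁ yb yc zb zc ∧ crB₁ yb yc zb zc ≠ crC₁ yb yc zb zc ∧
      crA₁ yb yc zb zc ≠ crC₁ yb yc zb zc) ∧
    (crA₂ yb yc zb zc ≠ crB₂ yb yc zb zc ∧ crB₂ yb yc zb zc ≠ crC₂ yb yc zb zc ∧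
      crA₂ yb yc zb zc ≠ crC₂ yb yc zb zc) ∧
    (crA₂ yb yc zb zc ≠ yc ∧ yc ≠ crC₁ yb yc zb zc ∧ crA₂ yb yc zb zc ≠ crC₁ yb yc zb zc) ∧
    (crA₁ yb yc zb zc ≠ crB₂ yb yc zb zc ∧ crB₂ yb yc zb zc ≠ zb ∧ crA₁ yb yc zb zc ≠ zb) ∧
    twice x₁ x₂ yb (crB₁ yb yc zb zc) zc (crC₂ yb yc zb zc) = true ∧
    (crB₁ yb yc zb zc ≠ yb ∧ crC₂ yb yc zb zc ≠ zc) := by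
  have h' := cr_spec_bool x₁ x₂ yb yc zb zc h
  rwa [crGood, decide_eq_true_iff] at h'

end Summit.MatrixMultiplication.MatrixMultiplication.Theorems.OutsiderSandwichToricCeilingPowSubTwoRules
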